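import Literature.InformationTheory.QuantumCodes.CSSPhenomenologicalThreshold
import Literature.InformationTheory.QuantumCodes.ToricCodePhenomenologicalClusterBound
import Literature.InformationTheory.QuantumCodes.InhomogeneousDensityBound
import Literature.InformationTheory.QuantumCodes.ToricCodePhenomenologicalAnisotropic
import HarnessLib

/-!
# Every CSS sector under INHOMOGENEOUS independent noise, and `T` noisy rounds with two rates `p ≠ q`:
# the Dumer–Kovalev–Pryadko cluster-counting thresholds with the rate replaced by its supremum — proved

Topic `Literature/InformationTheory/QuantumCodes` (venture QEC, LADDER-QEC rung Q5, PARTITION row 09 "noise models";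
qec-type-09 gen 4, item 09.ANISO). The tree's generic CSS-sector thresholds — code capacity
`sum_not_corrects_bernoulli_le_of_rowWeight` / `codeCapacityThreshold_of_rowWeight'` (Dumer–Kovalev–Pryadko Thm 2 at
`y = 0`, constant `2(w-1)√(p(1-p))`) and `T` noisy rounds `CSSPhenom.phenomFailureProb_le_of_rowWeight` /
`phenomThreshold_of_rowWeight'` (Thm 3, `w → w + 2`, `q = p`) — assume ONE i.i.d. rate `p`. This file PROVES the same
bounds, with the same constants, for INDEPENDENT NON-IDENTICAL rates bounded by `ρ ≤ 1/2` (the tree's `indepWeight r`),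
by swapping the i.i.d. half-density estimate for the exponential-Markov one (`sum_indepWeight_le_of_cover`,
`InhomogeneousDensityBound.lean`); the cluster extraction (`exists_irreducible_of_minWeight_not_corrects`) and the
cluster census (`sum_pow_card_irreducible_le`) are reused unchanged. (The locally-stochastic theorem of the tree,
`sum_decodingFails_le_of_rowWeight`, covers inhomogeneous independent noise too but only with the weaker constant
`2(w-1)√ρ`.) All PROVED, 0 facts, kernel axioms:

* **`sum_not_corrects_indep_le_of_rowWeight`** — any check matrix `H : Matrix ι V 𝔽₂` with rows of weight `≤ w`
  (`w ≥ 2`), `1 ≤ d ≤ ‖x‖` on `ker H ∖ SX`, any minimum-weight decoder, rates `0 ≤ r_v ≤ ρ ≤ 1/2`,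
  `r' := 2(w-1)√(ρ(1-ρ)) < 1`: `Σ_{e : D fails} w_r(e) ≤ |V| r'^d/((w-1)(1-r'))`;
* `codeCapacityThreshold_inhom_of_rowWeight'` — the family form (`|Q_i| r^{d_i} → 0` for all `r < 1`,
  `4(w-1)²ρ(1-ρ) < 1`, rates `r_i v ≤ ρ`) ⇒ `Σ_{fails} w_{r_i} → 0`;
* **`CSSPhenom.phenomFailureProb_le_aniso_of_rowWeight`** — `T` rounds, qubit rate `p`, measurement rate `q`,
  `p, q ≤ ρ ≤ 1/2`, `r' := 2(w+1)√(ρ(1-ρ)) < 1`: `Prob_fail(p,q) ≤ (|V|+|ι|)T r'^d/((w+1)(1-r'))`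
  (DKP15 Thm 3 shape; "errors on horizontal links … probability `p`, on vertical links … `q`", DKLP §4.2);
* `CSSPhenom.phenomThreshold_aniso_of_rowWeight'` — the family form: `(|Q_i|+|C_i|)T_i r^{d_i} → 0` for all
  `r < 1`, `4(w+1)²ρ(1-ρ) < 1`, `0 ≤ p, q ≤ ρ` ⇒ `Prob_fail(p,q) → 0`.

## References
* [DumerKovalevPryadko2015] I. Dumer, A. A. Kovalev, L. P. Pryadko, *Thresholds for correcting errors, erasures, and
  faulty syndrome measurements in degenerate quantum codes*, PRL 115 (2015) 050502, Thm 2 (y = 0), Thm 3, p. 5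
  (w → w + 2).
* [DennisEtAl2002] E. Dennis, A. Kitaev, A. Landahl, J. Preskill, *Topological quantum memory*, J. Math. Phys. 43
  (2002) 4452–4505, arXiv:quant-ph/0110143, §4.2 (rates p and q), §5.2 eqs. (27), (28).
-/

namespace Literature.InformationTheory.QuantumCodes

open Finset Matrix Filter Topology

/-! ### Code capacity with inhomogeneous independent rates, any CSS sector -/

section Generic

variable {ι V : Type*} [Fintype V] [DecidableEq V]

/-- A binary vector is determined by its support. [cite: DennisEtAl2002, §4.4 (n_E(ℓ) ∈ {0,1})] -/
theorem supp_injective_vec : Function.Injective (supp : (V → ZMod 2) → Finset V) :=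
  fun x y h => by rw [← indicator_supp x, ← indicator_supp y, h]

/-- **DKP15 Theorem 2 (`y = 0`) under INHOMOGENEOUS independent noise, finite length**: checks of weight `≤ w`
(`w ≥ 2`), `1 ≤ d ≤ ‖x‖` for all `x ∈ ker H ∖ SX`, a minimum-weight decoder, independent errors with rates
`0 ≤ r_v ≤ ρ ≤ 1/2`, `r' := 2(w-1)√(ρ(1-ρ)) < 1`: `Σ_{e : D fails on e} w_r(e) ≤ |V| r'^d / ((w-1)(1-r'))`.
[cite: DumerKovalevPryadko2015, Thm 2 (y = 0)] -/
theorem sum_not_corrects_indep_le_of_rowWeight (H : Matrix ι V (ZMod 2))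
    (SX : Submodule (ZMod 2) (V → ZMod 2)) {D : Decoder (ι → ZMod 2) (V → ZMod 2)}
    (hD : D.IsMinWeight (fun e => H *ᵥ e) {x | H *ᵥ x = 0} hammingNorm)
    [DecidablePred fun e : V → ZMod 2 => ¬ D.Corrects (fun e => H *ᵥ e) (SX : Set (V → ZMod 2)) e]
    {w : ℕ} (hw : 2 ≤ w) (hrow : ∀ i, (rowSupp H i).card ≤ w) {d : ℕ} (hd1 : 1 ≤ d)
    (hd : ∀ x : V → ZMod 2, H *ᵥ x = 0 → x ∉ SX → d ≤ hammingNorm x)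
    {r : V → ℝ} {ρ : ℝ} (hr0 : ∀ v, 0 ≤ r v) (hrρ : ∀ v, r v ≤ ρ) (hρ : ρ ≤ 1 / 2)
    (hr : 2 * ((w - 1 : ℕ) : ℝ) * Real.sqrt (ρ * (1 - ρ)) < 1) :
    ∑ e ∈ univ.filter (fun e : V → ZMod 2 => ¬ D.Corrects (fun e => H *ᵥ e) (SX : Set (V → ZMod 2)) e),
        indepWeight r (supp e) ≤
      (Fintype.card V : ℝ) * (2 * ((w - 1 : ℕ) : ℝ) * Real.sqrt (ρ * (1 - ρ))) ^ d /
        (((w - 1 : ℕ) : ℝ) * (1 - 2 * ((w - 1 : ℕ) : ℝ) * Real.sqrt (ρ * (1 - ρ)))) := by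
  classical
  set θ : ℝ := 2 * Real.sqrt (ρ * (1 - ρ)) with hθ
  have hθ0 : 0 ≤ θ := by positivity
  have hr' : ((w - 1 : ℕ) : ℝ) * θ < 1 := by rw [hθ]; linarith
  set F := univ.filter (fun e : V → ZMod 2 => ¬ D.Corrects (fun e => H *ᵥ e) (SX : Set (V → ZMod 2)) e)
    with hF
  have hsum : ∑ e ∈ F, indepWeight r (supp e) = ∑ E ∈ F.image supp, indepWeight r E :=
    (Finset.sum_image fun e₁ _ e₂ _ h => supp_injective_vec h).symm
  rw [hsum]
  set Ps : Finset (Finset V) := univ.filter (fun W => IsIrreducible H W ∧ d ≤ W.card) with hPs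
  have hcover : ∀ E ∈ F.image supp, ∃ W ∈ Ps,
      ((fun W : Finset V => W) W).card ≤ 2 * ((fun W : Finset V => W) W ∩ E).card := by
    intro E hE
    obtain ⟨e, he, rfl⟩ := Finset.mem_image.1 hE
    rw [hF, mem_filter] at he
    obtain ⟨W, hirr, hWS, hhalf⟩ := exists_irreducible_of_minWeight_not_corrects H SX hD he.2
    refine ⟨W, ?_, hhalf⟩
    rw [hPs, mem_filter]
    exact ⟨mem_univ _, hirr, hirr.le_card hd hWS⟩
  have h1 := sum_indepWeight_le_of_cover hr0 hrρ hρ Ps (fun W : Finset V => W) _ hcover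
  have h2 := sum_pow_card_irreducible_le H hw hrow hd1 hθ0 hr'
  have h3 : ((w - 1 : ℕ) : ℝ) * θ = 2 * ((w - 1 : ℕ) : ℝ) * Real.sqrt (ρ * (1 - ρ)) := by rw [hθ]; ring
  rw [h3] at h2
  exact h1.trans h2

end Generic

/-! ### Code-capacity threshold for CSS families under inhomogeneous independent noise -/

section Family

variable {C Q : ℕ → Type*} [∀ i, Fintype (Q i)] [∀ i, DecidableEq (Q i)]

open Classical in
/-- **DKP15 Theorem 2 (`y = 0`) as a threshold under INHOMOGENEOUS independent noise**: checks of weight `≤ w`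
(`w ≥ 2`), `1 ≤ d_i ≤` distance of the sector, minimum-weight decoders, sizes subexponential in the distance
(`|Q_i| r^{d_i} → 0` for all `0 < r < 1`), and link-dependent rates `0 ≤ r_i v ≤ ρ ≤ 1/2` with
`4(w-1)² ρ(1-ρ) < 1`: the failure probability tends to `0`. [cite: DumerKovalevPryadko2015, Thm 2 (y = 0, power-law distance)] -/
theorem codeCapacityThreshold_inhom_of_rowWeight' (H : ∀ i, Matrix (C i) (Q i) (ZMod 2))
    (SX : ∀ i, Submodule (ZMod 2) (Q i → ZMod 2)) (D : ∀ i, Decoder (C i → ZMod 2) (Q i → ZMod 2))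
    (hD : ∀ i, (D i).IsMinWeight (fun e => H i *ᵥ e) {x | H i *ᵥ x = 0} hammingNorm)
    {w : ℕ} (hw : 2 ≤ w) (hrow : ∀ i j, (rowSupp (H i) j).card ≤ w) (d : ℕ → ℕ) (hd1 : ∀ i, 1 ≤ d i)
    (hd : ∀ i (x : Q i → ZMod 2), H i *ᵥ x = 0 → x ∉ SX i → d i ≤ hammingNorm x)
    (hgrowth : ∀ r : ℝ, 0 < r → r < 1 →
      Tendsto (fun i => (Fintype.card (Q i) : ℝ) * r ^ d i) atTop (𝓝 0))
    {rate : ∀ i, Q i → ℝ} {ρ : ℝ} (hr0 : ∀ i v, 0 ≤ rate i v) (hrρ : ∀ i v, rate i v ≤ ρ) (hρ0 : 0 ≤ ρ)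
    (hρ : ρ ≤ 1 / 2) (h4 : 4 * ((w - 1 : ℕ) : ℝ) ^ 2 * (ρ * (1 - ρ)) < 1) :
    Tendsto (fun i => ∑ e ∈ univ.filter (fun e : Q i → ZMod 2 =>
        ¬ (D i).Corrects (fun e => H i *ᵥ e) (SX i : Set (Q i → ZMod 2)) e), indepWeight (rate i) (supp e))
      atTop (𝓝 0) := by
  set K : ℝ := ((w - 1 : ℕ) : ℝ) with hK
  have hK1 : 1 ≤ K := by
    rw [hK]
    exact_mod_cast (show 1 ≤ w - 1 by omega)
  have hK0 : 0 < K := by linarith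
  set s : ℝ := Real.sqrt (ρ * (1 - ρ)) with hs
  have hs0 : 0 ≤ s := Real.sqrt_nonneg _
  have hρρ : 0 ≤ ρ * (1 - ρ) := mul_nonneg hρ0 (by linarith)
  set r : ℝ := 2 * K * s with hrdef
  have hrr0 : 0 ≤ r := by positivity
  have hr1 : r < 1 := by
    have hsq : r ^ 2 = 4 * K ^ 2 * (ρ * (1 - ρ)) := by
      rw [hrdef, mul_pow, mul_pow, hs, Real.sq_sqrt hρρ]
      ring
    have h : r ^ 2 < 1 := by rw [hsq]; exact h4
    have := (sq_lt_one_iff_abs_lt_one r).1 h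
    rwa [abs_of_nonneg hrr0] at this
  have h1r : 0 < 1 - r := by linarith
  have hbound : ∀ i, ∑ e ∈ univ.filter (fun e : Q i → ZMod 2 =>
        ¬ (D i).Corrects (fun e => H i *ᵥ e) (SX i : Set (Q i → ZMod 2)) e), indepWeight (rate i) (supp e) ≤
      (Fintype.card (Q i) : ℝ) * r ^ d i / (K * (1 - r)) := by
    intro i
    have h := sum_not_corrects_indep_le_of_rowWeight (H i) (SX i) (hD i) hw (hrow i) (hd1 i) (hd i)
      (hr0 i) (hrρ i) hρ (by rw [← hK, ← hs]; exact hr1)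
    rw [← hK, ← hs] at h
    exact h
  have hnonneg : ∀ i, 0 ≤ ∑ e ∈ univ.filter (fun e : Q i → ZMod 2 =>
        ¬ (D i).Corrects (fun e => H i *ᵥ e) (SX i : Set (Q i → ZMod 2)) e), indepWeight (rate i) (supp e) :=
    fun i => Finset.sum_nonneg fun e _ =>
      indepWeight_nonneg (hr0 i) (fun v => (hrρ i v).trans (by linarith)) _
  have hQ : Tendsto (fun i => (Fintype.card (Q i) : ℝ) * r ^ d i / (K * (1 - r))) atTop (𝓝 0) := by
    rcases hrr0.eq_or_lt with hr00 | hrpos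
    · have : (fun i => (Fintype.card (Q i) : ℝ) * r ^ d i / (K * (1 - r))) = fun _ => 0 := by
        funext i
        rw [← hr00, zero_pow (by have := hd1 i; omega)]
        simp
      rw [this]
      exact tendsto_const_nhds
    · have h := (hgrowth r hrpos hr1).div_const (K * (1 - r))
      simpa using h
  exact squeeze_zero hnonneg hbound hQ

end Family

/-! ### `T` noisy rounds with two rates `p` (qubits) and `q` (measurements), any CSS sector -/

namespace CSSPhenom

variable {ι V : Type*} {T : ℕ} {H : Matrix ι V (ZMod 2)}

/-- **DKP15 Theorem 3 shape with TWO rates, finite size, any CSS sector** (UNCONDITIONAL, kernel): checks of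
weight `≤ w`, `1 ≤ d ≤` the weights of `ker H ∖ SX`, any number of rounds `T`, any minimum-weight space-time
decoder, qubit rate `p` and measurement rate `q` with `0 ≤ p, q ≤ ρ ≤ 1/2`, `r := 2(w+1)√(ρ(1-ρ)) < 1`:
`Prob_fail(p, q) ≤ (|V| + |ι|)T · r^d / ((w+1)(1 - r))`.
[cite: DumerKovalevPryadko2015, Thm 3 with p. 5 (w → w + 2); DKLP §4.2 (rates p, q)] -/
theorem phenomFailureProb_le_aniso_of_rowWeight [Fintype ι] [DecidableEq ι] [Fintype V] [DecidableEq V]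
    (SX : Submodule (ZMod 2) (V → ZMod 2)) {D : STDecoder ι V T}
    (hD : D.IsMinWeight (stSyn H T) (stCycles H T) hammingNorm)
    {w : ℕ} (hrow : ∀ c, (rowSupp H c).card ≤ w) {d : ℕ} (hd1 : 1 ≤ d)
    (hd : ∀ x : V → ZMod 2, H *ᵥ x = 0 → x ∉ SX → d ≤ hammingNorm x)
    {p q ρ : ℝ} (hp0 : 0 ≤ p) (hq0 : 0 ≤ q) (hpρ : p ≤ ρ) (hqρ : q ≤ ρ) (hρ : ρ ≤ 1 / 2)
    (hr : 2 * ((w + 1 : ℕ) : ℝ) * Real.sqrt (ρ * (1 - ρ)) < 1) :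
    phenomFailureProb H T (SX : Set (V → ZMod 2)) D p q ≤
      (((Fintype.card V + Fintype.card ι) * T : ℕ) : ℝ) *
          (2 * ((w + 1 : ℕ) : ℝ) * Real.sqrt (ρ * (1 - ρ))) ^ d /
        (((w + 1 : ℕ) : ℝ) * (1 - 2 * ((w + 1 : ℕ) : ℝ) * Real.sqrt (ρ * (1 - ρ)))) := by
  classical
  have hD' : D.IsMinWeight (fun e : History ι V T => stMatrix H T *ᵥ e) {x | stMatrix H T *ᵥ x = 0}
      hammingNorm := hD
  have hd' : ∀ x : History ι V T, stMatrix H T *ᵥ x = 0 → x ∉ stTrivialSubmodule T SX →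
      d ≤ hammingNorm x :=
    fun x hx hxS => le_hammingNorm_of_stCycle_not_trivial hd hx hxS
  have hw2 : ((w + 2 - 1 : ℕ) : ℝ) = ((w + 1 : ℕ) : ℝ) := by
    congr 1
  have hr' : 2 * ((w + 2 - 1 : ℕ) : ℝ) * Real.sqrt (ρ * (1 - ρ)) < 1 := by rwa [hw2]
  have hmain := sum_not_corrects_indep_le_of_rowWeight (stMatrix H T) (stTrivialSubmodule T SX) hD'
    (w := w + 2) (by omega) (card_rowSupp_stMatrix_le hrow) hd1 hd'
    (ToricCode.phenomRate_nonneg hp0 hq0) (ToricCode.phenomRate_le hpρ hqρ) hρ hr'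
  have hsame : phenomFailureProb H T (SX : Set (V → ZMod 2)) D p q =
      ∑ e ∈ univ.filter (fun e : History ι V T =>
        ¬ D.Corrects (fun e => stMatrix H T *ᵥ e)
          ((stTrivialSubmodule T SX : Submodule (ZMod 2) (History ι V T)) : Set (History ι V T)) e),
        indepWeight (phenomRate p q) (supp e) := by
    unfold phenomFailureProb
    refine Finset.sum_congr ?_ fun E _ => rfl
    ext E
    simp only [mem_filter, mem_univ, true_and, coe_stTrivialSubmodule]
    rfl
  rw [hsame]
  refine hmain.trans (le_of_eq ?_)
  rw [card_historyLoc, hw2]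

section Family

variable {C Q : ℕ → Type*} [∀ i, Fintype (C i)] [∀ i, DecidableEq (C i)] [∀ i, Fintype (Q i)]
  [∀ i, DecidableEq (Q i)]

/-- **Two-rate phenomenological threshold for every CSS LDPC family** (minimum-weight space-time decoding;
UNCONDITIONAL, kernel): one error type, checks of weight `≤ w`, `1 ≤ d_i ≤` distance, numbers of rounds `T_i`,
space-time size subexponential in the distance — `(|Q_i| + |C_i|) T_i r^{d_i} → 0` for every `0 < r < 1` —, ANY
minimum-weight space-time decoders; then all qubit/measurement rates `0 ≤ p, q ≤ ρ` with `4(w+1)² ρ(1-ρ) < 1`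
have `Prob_fail(p, q) → 0`. [cite: DumerKovalevPryadko2015, Thm 3 with p. 5 (w → w + 2); DKLP §5.3 (p, q < threshold)] -/
theorem phenomThreshold_aniso_of_rowWeight' (H : ∀ i, Matrix (C i) (Q i) (ZMod 2))
    (SX : ∀ i, Submodule (ZMod 2) (Q i → ZMod 2)) (T : ℕ → ℕ)
    (D : ∀ i, STDecoder (C i) (Q i) (T i))
    (hD : ∀ i, (D i).IsMinWeight (stSyn (H i) (T i)) (stCycles (H i) (T i)) hammingNorm)
    {w : ℕ} (hrow : ∀ i j, (rowSupp (H i) j).card ≤ w) (d : ℕ → ℕ) (hd1 : ∀ i, 1 ≤ d i)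
    (hd : ∀ i (x : Q i → ZMod 2), H i *ᵥ x = 0 → x ∉ SX i → d i ≤ hammingNorm x)
    (hgrowth : ∀ r : ℝ, 0 < r → r < 1 →
      Tendsto (fun i => (((Fintype.card (Q i) + Fintype.card (C i)) * T i : ℕ) : ℝ) * r ^ d i)
        atTop (𝓝 0))
    {p q ρ : ℝ} (hp0 : 0 ≤ p) (hq0 : 0 ≤ q) (hpρ : p ≤ ρ) (hqρ : q ≤ ρ) (hρ : ρ ≤ 1 / 2)
    (h4 : 4 * ((w + 1 : ℕ) : ℝ) ^ 2 * (ρ * (1 - ρ)) < 1) :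
    Tendsto (fun i => phenomFailureProb (H i) (T i) (SX i : Set (Q i → ZMod 2)) (D i) p q) atTop (𝓝 0) := by
  classical
  set K : ℝ := ((w + 1 : ℕ) : ℝ) with hK
  have hK1 : 1 ≤ K := by
    rw [hK]
    exact_mod_cast (show 1 ≤ w + 1 by omega)
  have hK0 : 0 < K := by linarith
  have hρ0 : 0 ≤ ρ := hp0.trans hpρ
  set s : ℝ := Real.sqrt (ρ * (1 - ρ)) with hs
  have hs0 : 0 ≤ s := Real.sqrt_nonneg _
  have hρρ : 0 ≤ ρ * (1 - ρ) := mul_nonneg hρ0 (by linarith)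
  set r : ℝ := 2 * K * s with hrdef
  have hr0 : 0 ≤ r := by positivity
  have hr1 : r < 1 := by
    have hsq : r ^ 2 = 4 * K ^ 2 * (ρ * (1 - ρ)) := by
      rw [hrdef, mul_pow, mul_pow, hs, Real.sq_sqrt hρρ]
      ring
    have h : r ^ 2 < 1 := by rw [hsq]; exact h4
    have := (sq_lt_one_iff_abs_lt_one r).1 h
    rwa [abs_of_nonneg hr0] at this
  have h1r : 0 < 1 - r := by linarith
  have hbound : ∀ i, phenomFailureProb (H i) (T i) (SX i : Set (Q i → ZMod 2)) (D i) p q ≤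
      (((Fintype.card (Q i) + Fintype.card (C i)) * T i : ℕ) : ℝ) * r ^ d i / (K * (1 - r)) := by
    intro i
    have h := phenomFailureProb_le_aniso_of_rowWeight (SX i) (hD i) (hrow i) (hd1 i) (hd i) hp0 hq0 hpρ hqρ hρ
      (by rw [← hK, ← hs]; exact hr1)
    rw [← hK, ← hs] at h
    exact h
  have hnonneg : ∀ i, 0 ≤ phenomFailureProb (H i) (T i) (SX i : Set (Q i → ZMod 2)) (D i) p q := by
    intro i
    unfold phenomFailureProb phenomenologicalWeight
    refine Finset.sum_nonneg fun E _ =>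
      indepWeight_nonneg (ToricCode.phenomRate_nonneg hp0 hq0) (fun ℓ => ?_) _
    exact (ToricCode.phenomRate_le hpρ hqρ ℓ).trans (by linarith)
  have hQ : Tendsto (fun i => (((Fintype.card (Q i) + Fintype.card (C i)) * T i : ℕ) : ℝ) * r ^ d i /
      (K * (1 - r))) atTop (𝓝 0) := by
    rcases hr0.eq_or_lt with hr00 | hrpos
    · have : (fun i => (((Fintype.card (Q i) + Fintype.card (C i)) * T i : ℕ) : ℝ) * r ^ d i /
          (K * (1 - r))) = fun _ => 0 := by
        funext i
        rw [← hr00, zero_pow (by have := hd1 i; omega)]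
        simp
      rw [this]
      exact tendsto_const_nhds
    · have h := (hgrowth r hrpos hr1).div_const (K * (1 - r))
      simpa using h
  exact squeeze_zero hnonneg hbound hQ

end Family

end CSSPhenom

end Literature.InformationTheory.QuantumCodes
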